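import Mathlib
import Literature.Computability.AlgebraicComplexity.StandardFamilies

/-!
# Typed level decompositions of the permanent — definitions for the rung `PairTiedTorusBound`
# (crux `RankRigidMinimalRepr`, stmt-ValiantsHypothesis-18034, route `RigidityForcesSymmetry`)

The forward rung `PairTiedTorusBound` of the crux workfile
`Cruxes/RankRigidMinimalRepr/Lines/PairTiedTorusBound.lean` (Grenet's bound `2 ^ m - 1 ≤ n` for affine determinantal
representations of `perm_m` equivariant under the two-sided torus `x_{kj} ↦ d_k e_j x_{kj}` with ONE pair of column scalars
tied, `e₀ = e₁`) is composed from two registered stubs, `stub_levelDecomp` (dictionary: an equivariant representation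
of size `n` yields, at every level `1 ≤ s ≤ m - 1`, a TYPED LEVEL DECOMPOSITION of `perm_m` with `w s` products,
`1 + Σ_s w s ≤ n`) and `stub_levelBound` (the count: with one tied pair every level-`s` typed decomposition still needs
`C(m, s)` products).  Both stubs are stated in terms of the workfile's definitions `IsTiedTyped` /
`TiedLevelDecomposable`, which live in a `Cruxes/` module that `Theorems/` files cannot import (precedent:
`Theorems/FreeSubtorusConfusionCoveringDefs.lean`).

This file gives the two notions tree names, with bodies VERBATIM the workfile's (same binder names, same order, same
clauses), so that `TiedLevelDecomposable m k s w` here is the same proposition as the workfile's, the stub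
`stub_levelBound` can be landed in `Theorems/` against this file by name
(`Theorems/RigidityForcesSymmetryRankRigidMinimalReprStubLevelBound.lean`), and the workfile may replace its local
definitions by these:

* `IsTiedTyped m k I c ct P` — every monomial of `P` has degree `1` in each row of `I` and `0` in the other rows,
  degree `c j` in each untied column `j` (`k < j`), and total degree `ct` in the tied columns `j ≤ k` (the weight spaces
  of a generic element of the torus with the column scalars `e_0, …, e_k` tied, acting on polynomials in the `x_{ij}`);
* `TiedLevelDecomposable m k s w` — `perm_m = Σ_{t < w} P_t · Q_t` with `P_t` typed by an `s`-set of rows `I_t` and a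
  column profile, `Q_t` typed by the complementary rows and the complementary profile (the cut of a torus-graded
  homogeneous algebraic branching program for `perm_m` at degree `s`; Grenet's construction / Laplace expansion along
  `s` rows gives one with `w = C(m, s)`).

Conventions: `perPoly (Fin m) ℂ` is the tree's generic permanent (`Literature…StandardFamilies`); a variable
`(i, j) : Fin m × Fin m` has ROW `i` and COLUMN `j` (first / second coordinate), as in the workfile.
HONEST FRAMING: definitions only; nothing of the crux, the rung or `VP ≠ VNP` is asserted here.
[cite: LandsbergRessayre2017, §6] [cite: Nisan1991]
-/

set_option autoImplicit false

-- the mandated summit-side namespace repeats a component by design (single-problem summit)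
set_option linter.dupNamespace false

namespace Summit.ValiantsHypothesis.ValiantsHypothesis.Theorems.RigidityForcesSymmetryPairTiedTorusBound

open Literature.Computability.AlgebraicComplexity

/-- `P` is TYPED by the row set `I`, the untied column profile `c` and the tied total `ct` (tie on the columns
`j ≤ k`): every monomial of `P` has degree `1` in each row of `I` and `0` in the other rows, degree `c j` in each
untied column `j` (`k < j`), and total degree `ct` in the tied columns.  (These are exactly the weight spaces of a
generic element of the tied torus acting on polynomials.)  Verbatim the crux workfile's
`Cruxes.RankRigidMinimalRepr.PairTiedTorusBound.IsTiedTyped`. [cite: LandsbergRessayre2017, §6] -/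
def IsTiedTyped (m k : ℕ) (I : Finset (Fin m)) (c : Fin m → ℕ) (ct : ℕ)
    (P : MvPolynomial (Fin m × Fin m) ℂ) : Prop :=
  ∀ d ∈ P.support,
    (∀ i : Fin m, (∑ j : Fin m, d (i, j)) = if i ∈ I then 1 else 0) ∧
    (∀ j : Fin m, k < j.val → (∑ i : Fin m, d (i, j)) = c j) ∧
    (∑ j ∈ Finset.univ.filter (fun j : Fin m => j.val ≤ k), ∑ i : Fin m, d (i, j)) = ct

/-- `perm_m` has a LEVEL-`s` TYPED DECOMPOSITION WITH `w` PRODUCTS for the tie `k`: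
`perm_m = Σ_{t < w} P_t · Q_t` with `P_t` typed by an `s`-set of rows `I_t` (untied profile `c t`, tied total `ct t`)
and `Q_t` typed by the complementary rows and the complementary column profile (`c t j + c' t j = 1` on untied
columns, `ct t + ct' t =` the number of tied columns).  (Cut of a tied-torus-graded homogeneous ABP at degree `s`;
Grenet / Laplace along `s` rows give one with `w = C(m, s)`.)  Verbatim the crux workfile's
`Cruxes.RankRigidMinimalRepr.PairTiedTorusBound.TiedLevelDecomposable`. [cite: LandsbergRessayre2017, §6] -/
def TiedLevelDecomposable (m k s w : ℕ) : Prop :=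
  ∃ (I : Fin w → Finset (Fin m)) (c c' : Fin w → Fin m → ℕ) (ct ct' : Fin w → ℕ)
    (P Q : Fin w → MvPolynomial (Fin m × Fin m) ℂ),
    (∀ t, (I t).card = s) ∧
    (∀ t, IsTiedTyped m k (I t) (c t) (ct t) (P t)) ∧
    (∀ t, IsTiedTyped m k (I t)ᶜ (c' t) (ct' t) (Q t)) ∧
    (∀ t, ∀ j : Fin m, k < j.val → c t j + c' t j = 1) ∧
    (∀ t, ct t + ct' t = (Finset.univ.filter (fun j : Fin m => j.val ≤ k)).card) ∧
    perPoly (Fin m) ℂ = ∑ t, P t * Q t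

end Summit.ValiantsHypothesis.ValiantsHypothesis.Theorems.RigidityForcesSymmetryPairTiedTorusBound
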